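import Summits.Parity.GeneralizedHardyLittlewood.Theorems.FordMaynardSieveConst01651SieveConst01651Dim5Final
import HarnessLib

/-!
# Route `FordMaynardSieveConst01651`, target `SieveConst01651` (stmt-Parity-19185), line `sieve_decomposition` (v21):
# stub `stub_signClauseFive` BY NAME

The v21 registered stub `stub_signClauseFive` (R1, FINITE: the dimension-5 sign clause of the landed witness `coneCert` at
generic points, couple form) is VERBATIM `…Dim5Final.coneCert_generic_five` (the dimension-5 type checker evaluated in the
kernel with standard axioms — no `native_decide`).  This def-free helper lands it under the registered name so the item's
stub census records it.

References: [FordMaynard2024PrimeSieves] arXiv:2407.14368, Theorem 7.3 (a), §8.2.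
-/

noncomputable section

open Finset
open Literature.NumberTheory.Sieve Literature.NumberTheory.Sieve.FordMaynard

namespace Summit.Parity.GeneralizedHardyLittlewood.FordMaynardSieveConst01651SieveConst01651

/-- **Stub `stub_signClauseFive` of line `sieve_decomposition` (v21), registered signature verbatim**: at every generic
point `x` of the open chamber `ℋ₅` (increasing coordinates in `(0.1651, 0.8349)` summing to `1`, all in `openSmall`, no pair
sum on a band edge) the couple sum of the witness `coneCert` over the ten 2-subsets `A ⊂ Fin 5` is at most `4`.
Proof: `coneCert_generic_five` (kernel-evaluated dimension-5 type checker, `…Dim5Final`).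
[cite: FordMaynard2024PrimeSieves, Theorem 7.3 (a), §8.2] -/
theorem stub_signClauseFive :
    ∀ x : Fin 5 → ℝ, Monotone x → (∀ i, (1651 / 10000 : ℝ) < x i ∧ x i < 1 - 1651 / 10000) →
      ∑ i, x i = 1 → (∀ i, x i ∈ openSmall) →
      (∀ i j, i < j → x i + x j ≠ 8349 / 20000 ∧ x i + x j ≠ 1 / 2) →
      -4 + ∑ A ∈ (Finset.univ : Finset (Finset (Fin 5))).filter (fun A => A.card = 2),
        (coneCert A.card (fun i => x (A.orderEmbOfFin rfl i)) +
          coneCert Aᶜ.card (fun i => x (Aᶜ.orderEmbOfFin rfl i))) ≤ 0 :=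
  coneCert_generic_five

end Summit.Parity.GeneralizedHardyLittlewood.FordMaynardSieveConst01651SieveConst01651

end
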